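import HarnessLib
import Literature.NumberTheory.LFunctions.WeilMellinInversion
import Literature.NumberTheory.LFunctions.WeilArchimedeanPositivityProofs
import Literature.NumberTheory.LFunctions.WeilArchimedeanMoments
import Summits.RiemannHypothesis.RiemannHypothesis.Theorems.SignConeSignConeOscillatoryStubCombPairing

/-!
# Route SignCone: the unit-slack sign-cone functional as a spectral integral (pointwise-certificate format)

Support for the unconditional rungs of `SignConeOscillatory` / `SignConeInequality`
(items stmt-RiemannHypothesis-16302 / 16301) and for the per-cutoff form `FZM_b` of the terminal stub
`stub_fakeZeroMeasure` of line `Sketch` on the crux.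

For a Weil test `g` supported in `[-b, b]`, `G = g ⋆ g̃` (supported in `[-2b, 2b]`), real fake
weights `a_n` on finitely many nodes `n`, a slack `s`, and ANY continuous compactly supported real
function `E` with `E(x) = e^{x/2} + e^{-x/2}` on `[-2b, 2b]` (the part of `E` beyond `2b` is
invisible to `G`), the slack sign-cone functional is a spectral integral against an explicit density:

  `Re (W_ar(G) − Σ_n (a_n/2)(G(log n) + G(−log n))) + s‖g‖₂² = (1/2π) ∫ |ĝ(1/2+iy)|² F(y) dy`,
  `F(y) = Re ψ(1/4 + iy/2) − log π + s + Ê(y) − Σ_n a_n cos(y log n)`,  `Ê(y) = ∫ E(x) cos(xy) dx`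

(`slackFunctional_eq_spectralIntegral`): polar term by Mellin inversion for `G` on the critical
line + Fubini (`re_integral_weilConv_weilReflect_mul_eq`, Parseval with an `L¹` kernel), archimedean
term by `weilArchIntegral_weilConv_weilReflect`, `‖g‖₂²` by Plancherel, nodes by
`inv_two_pi_mul_integral_norm_sq_weilMellin_mul_two_cos`.
Consequence (`neg_slack_le_of_density_nonneg`): if `F ≥ 0` pointwise then
`-s‖g‖₂² ≤ Re (W_ar(G) − Σ (a_n/2)(G(log n)+G(−log n)))` on `C(b)` — the hypothesis of
`signConeOscillatory_upTo_of_fakeWeight_unitSlack` at the single cutoff `b` (with `c_n = a_n √n/2`),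
obtained from a POINTWISE inequality for an explicit function of one real variable (certified by
interval arithmetic in the sibling files); `σ = F(y) dy/2π ≥ 0` is then a fake-zero measure at
cutoff `b`.
-/

noncomputable section

-- `Summit.RiemannHypothesis.RiemannHypothesis.…` repeats a namespace component by design (D-0017 layout).
set_option linter.dupNamespace false

open scoped BigOperators ComplexConjugate Real Topology
open Complex MeasureTheory Set Filter

namespace Summit.RiemannHypothesis.RiemannHypothesis.Theorems.SignCone

open Literature.NumberTheory.LFunctions
open Summit.RiemannHypothesis.RiemannHypothesis.Theorems.SignConeOscillatory

/-- The cosine transform `Ê(y) = ∫ E(x) cos(xy) dx` of a real kernel. [folklore] -/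
def cosTransform (E : ℝ → ℝ) (y : ℝ) : ℝ := ∫ x : ℝ, E x * Real.cos (x * y)

section Kernel

variable {E : ℝ → ℝ} (hEc : Continuous E) (hEs : HasCompactSupport E)
include hEc hEs

/-- `E` is integrable. [folklore] -/
theorem integrable_kernel : Integrable E :=
  hEc.integrable_of_hasCompactSupport hEs

/-- `x ↦ E(x) cos(xy)` is integrable. [folklore] -/
theorem integrable_kernel_mul_cos (y : ℝ) : Integrable fun x : ℝ => E x * Real.cos (x * y) :=
  (hEc.mul (by fun_prop)).integrable_of_hasCompactSupport hEs.mul_right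

/-- `|Ê(y)| ≤ ‖E‖₁`. [folklore] -/
theorem abs_cosTransform_le (y : ℝ) : |cosTransform E y| ≤ ∫ x : ℝ, |E x| := by
  unfold cosTransform
  refine (abs_integral_le_integral_abs (f := fun x => E x * Real.cos (x * y))).trans ?_
  refine integral_mono_of_nonneg (Eventually.of_forall fun x => abs_nonneg _)
    (integrable_kernel hEc hEs).abs (Eventually.of_forall fun x => ?_)
  simp only
  rw [abs_mul]
  exact mul_le_of_le_one_right (abs_nonneg _) (Real.abs_cos_le_one _)

/-- `Ê` is continuous (dominated convergence). [folklore] -/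
theorem continuous_cosTransform : Continuous (cosTransform E) := by
  unfold cosTransform
  refine continuous_of_dominated (bound := fun x => |E x|) (fun y => ?_) (fun y => ?_)
    (integrable_kernel hEc hEs).abs ?_
  · exact ((hEc.mul (by fun_prop)).aestronglyMeasurable :
      AEStronglyMeasurable (fun x => E x * Real.cos (x * y)) volume)
  · refine Eventually.of_forall fun x => ?_
    rw [Real.norm_eq_abs, abs_mul]
    exact mul_le_of_le_one_right (abs_nonneg _) (Real.abs_cos_le_one _)
  · exact Eventually.of_forall fun x => by fun_prop

omit hEc hEs in
/-- `Ê` is even. [folklore] -/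
theorem cosTransform_neg (y : ℝ) : cosTransform E (-y) = cosTransform E y := by
  unfold cosTransform
  congr 1 with x
  rw [mul_neg, Real.cos_neg]

/-- The complex kernel transform `∫ E(x) e^{-iyx} dx` has real part `Ê(y)`. [folklore] -/
theorem re_integral_kernel_mul_cexp (y : ℝ) :
    (∫ x : ℝ, (E x : ℂ) * cexp (-(y * I) * x)).re = cosTransform E y := by
  have hi : Integrable fun x : ℝ => (E x : ℂ) * cexp (-(y * I) * x) := by
    refine ((continuous_ofReal.comp hEc).mul (by fun_prop)).integrable_of_hasCompactSupport ?_
    exact (hEs.comp_left Complex.ofReal_zero).mul_right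
  have hre := integral_re hi
  simp only [RCLike.re_to_complex] at hre
  rw [← hre]
  unfold cosTransform
  congr 1 with x
  have e : -(y * I : ℂ) * (x : ℂ) = ((-(x * y) : ℝ) : ℂ) * I := by push_cast; ring
  rw [e, Complex.re_ofReal_mul, Complex.exp_ofReal_mul_I_re, Real.cos_neg]

end Kernel

section Parseval

variable {g : ℝ → ℂ} (hg : IsWeilTest g) {E : ℝ → ℝ} (hEc : Continuous E) (hEs : HasCompactSupport E)
include hg hEc hEs

/-- **Parseval with an `L¹` kernel (complex form).** For `G = g ⋆ g̃`,
`∫ G(x) E(x) dx = (1/2π) ∫ |ĝ(1/2+iy)|² (∫ E(x) e^{-iyx} dx) dy` — Mellin inversion for `G` on the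
critical line (`weilMellin_inversion`) and Fubini. [folklore] -/
theorem integral_weilConv_weilReflect_mul_eq :
    ∫ x : ℝ, weilConv g (weilReflect g) x * (E x : ℂ) =
      (1 / (2 * π) : ℂ) * ∫ y : ℝ, ((‖weilMellin g (1 / 2 + y * I)‖ ^ 2 : ℝ) : ℂ) *
        ∫ x : ℝ, (E x : ℂ) * cexp (-(y * I) * x) := by
  set k : ℝ → ℂ := weilConv g (weilReflect g) with hk_def
  have hk : IsWeilTest k := hg.weilConv hg.weilReflect
  have hpi : (2 * π : ℂ) ≠ 0 := by exact_mod_cast (by positivity : (2 * π : ℝ) ≠ 0)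
  -- Mellin inversion on the critical line, pointwise in `x`
  have hinv : ∀ x : ℝ, k x = (1 / (2 * π) : ℂ) *
      ∫ y : ℝ, weilMellin k ((1 / 2 : ℝ) + y * I) * cexp (-(y * I) * x) := by
    intro x
    have h := weilMellin_inversion hk (1 / 2) x
    have e0 : ((1 / 2 : ℝ) : ℂ) - 1 / 2 = 0 := by push_cast; ring
    simp only [e0, zero_mul, Complex.exp_zero, mul_one] at h
    rw [h, ← mul_assoc, show (1 / (2 * π) : ℂ) * (2 * π) = 1 by field_simp, one_mul]
  -- the integrand on ℝ × ℝ and its integrability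
  set Φ : ℝ → ℝ → ℂ := fun x y =>
    weilMellin k ((1 / 2 : ℝ) + y * I) * cexp (-(y * I) * x) * (E x : ℂ) with hΦ
  have hEi : Integrable E := integrable_kernel hEc hEs
  have hMi : Integrable fun y : ℝ => weilMellin k ((1 / 2 : ℝ) + y * I) :=
    integrable_weilMellin_vertical hk (1 / 2)
  have hΦc : Continuous (Function.uncurry Φ) := by
    rw [hΦ]
    have h1 : Continuous fun p : ℝ × ℝ => weilMellin k ((1 / 2 : ℝ) + p.2 * I) :=
      (continuous_weilMellin_vertical hk.1.continuous hk.2 (1 / 2)).comp continuous_snd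
    have h2 : Continuous fun p : ℝ × ℝ => cexp (-(p.2 * I) * p.1) := by fun_prop
    have h3 : Continuous fun p : ℝ × ℝ => (E p.1 : ℂ) := continuous_ofReal.comp (hEc.comp continuous_fst)
    exact (h1.mul h2).mul h3
  have hΦi : Integrable (Function.uncurry Φ) (volume.prod volume) := by
    have hprod : Integrable (fun p : ℝ × ℝ => (‖E p.1‖ : ℝ) * ‖weilMellin k ((1 / 2 : ℝ) + p.2 * I)‖)
        (volume.prod volume) := hEi.norm.mul_prod hMi.norm
    refine hprod.mono' hΦc.aestronglyMeasurable (Eventually.of_forall fun p => ?_)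
    obtain ⟨x, y⟩ := p
    rw [hΦ]
    show ‖weilMellin k ((1 / 2 : ℝ) + y * I) * cexp (-(y * I) * x) * (E x : ℂ)‖ ≤
      ‖E x‖ * ‖weilMellin k ((1 / 2 : ℝ) + y * I)‖
    rw [norm_mul, norm_mul]
    have he : ‖cexp (-(y * I) * x)‖ = 1 := by
      rw [show -(y * I : ℂ) * (x : ℂ) = ((-(x * y) : ℝ) : ℂ) * I by push_cast; ring,
        Complex.norm_exp_ofReal_mul_I]
    rw [he, mul_one, Complex.norm_real, mul_comm]
  -- LHS as an iterated integral
  have hL : (∫ x : ℝ, k x * (E x : ℂ)) = (1 / (2 * π) : ℂ) * ∫ x : ℝ, ∫ y : ℝ, Φ x y := by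
    calc (∫ x : ℝ, k x * (E x : ℂ))
        = ∫ x : ℝ, (1 / (2 * π) : ℂ) *
            ((∫ y : ℝ, weilMellin k ((1 / 2 : ℝ) + y * I) * cexp (-(y * I) * x)) * (E x : ℂ)) := by
          congr 1 with x
          rw [hinv x]
          ring
      _ = (1 / (2 * π) : ℂ) *
            ∫ x : ℝ, (∫ y : ℝ, weilMellin k ((1 / 2 : ℝ) + y * I) * cexp (-(y * I) * x)) * (E x : ℂ) :=
          integral_const_mul _ _
      _ = (1 / (2 * π) : ℂ) * ∫ x : ℝ, ∫ y : ℝ, Φ x y := by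
          congr 1
          congr 1 with x
          rw [← integral_mul_const]
  rw [hL, integral_integral_swap hΦi]
  congr 1
  congr 1 with y
  rw [hΦ]
  simp only
  have e1 : ((1 / 2 : ℝ) : ℂ) + y * I = 1 / 2 + y * I := by push_cast; ring
  rw [e1, weilMellin_weilConv_weilReflect_half hg y, ← integral_const_mul]
  congr 1 with x
  ring

/-- **Parseval with an `L¹` kernel (real form).** `Re ∫ G(x) E(x) dx = (1/2π) ∫ |ĝ(1/2+iy)|² Ê(y) dy`
for `G = g ⋆ g̃`. [folklore] -/
theorem re_integral_weilConv_weilReflect_mul_eq :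
    (∫ x : ℝ, weilConv g (weilReflect g) x * (E x : ℂ)).re =
      1 / (2 * π) * ∫ y : ℝ, ‖weilMellin g (1 / 2 + y * I)‖ ^ 2 * cosTransform E y := by
  rw [integral_weilConv_weilReflect_mul_eq hg hEc hEs]
  set W : ℝ → ℂ := fun y => ∫ x : ℝ, (E x : ℂ) * cexp (-(y * I) * x) with hW
  have hWc : Continuous W := by
    rw [hW]
    refine continuous_of_dominated (bound := fun x => |E x|) (fun y => ?_) (fun y => ?_)
      (integrable_kernel hEc hEs).abs ?_
    · exact ((continuous_ofReal.comp hEc).mul (by fun_prop)).aestronglyMeasurable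
    · refine Eventually.of_forall fun x => ?_
      rw [norm_mul, Complex.norm_real, Real.norm_eq_abs,
        show -(y * I : ℂ) * (x : ℂ) = ((-(x * y) : ℝ) : ℂ) * I by push_cast; ring,
        Complex.norm_exp_ofReal_mul_I, mul_one]
    · exact Eventually.of_forall fun x => by fun_prop
  have hWb : ∀ y, ‖W y‖ ≤ ∫ x : ℝ, |E x| := by
    intro y
    rw [hW]
    refine (norm_integral_le_integral_norm _).trans (le_of_eq ?_)
    congr 1 with x
    rw [norm_mul, Complex.norm_real, Real.norm_eq_abs,
      show -(y * I : ℂ) * (x : ℂ) = ((-(x * y) : ℝ) : ℂ) * I by push_cast; ring,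
      Complex.norm_exp_ofReal_mul_I, mul_one]
  -- integrability of `y ↦ |ĝ|² W(y)`
  have hI : Integrable fun y : ℝ => ((‖weilMellin g (1 / 2 + y * I)‖ ^ 2 : ℝ) : ℂ) * W y := by
    have hb := (integrable_norm_sq_weilMellin_half_line hg).const_mul (∫ x : ℝ, |E x|)
    refine hb.mono' ?_ (Eventually.of_forall fun y => ?_)
    · exact (continuous_ofReal.comp (continuous_norm_sq_weilMellin_half_line hg)).mul hWc
        |>.aestronglyMeasurable
    · rw [norm_mul, Complex.norm_real, Real.norm_eq_abs, abs_of_nonneg (by positivity), mul_comm]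
      exact mul_le_mul_of_nonneg_right (hWb y) (by positivity)
  have e2 : ((1 / (2 * π) : ℂ) * ∫ y : ℝ, ((‖weilMellin g (1 / 2 + y * I)‖ ^ 2 : ℝ) : ℂ) * W y).re =
      1 / (2 * π) * (∫ y : ℝ, ((‖weilMellin g (1 / 2 + y * I)‖ ^ 2 : ℝ) : ℂ) * W y).re := by
    rw [show (1 / (2 * π) : ℂ) = ((1 / (2 * π) : ℝ) : ℂ) by push_cast; ring, Complex.re_ofReal_mul]
  have hre := integral_re hI
  simp only [RCLike.re_to_complex] at hre
  rw [e2, ← hre]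
  congr 1
  congr 1 with y
  rw [Complex.re_ofReal_mul, hW]
  simp only
  rw [re_integral_kernel_mul_cexp hEc hEs y]

end Parseval

section Terms

variable {g : ℝ → ℂ} (hg : IsWeilTest g)
include hg

/-- **The polar term, spectrally.** If `E = e^{x/2} + e^{-x/2}` on `[-2b, 2b] ⊇ tsupport (g ⋆ g̃)` then
`Re (Ĝ(0) + Ĝ(1)) = (1/2π) ∫ |ĝ(1/2+iy)|² Ê(y) dy`. [folklore] -/
theorem re_weilPolarTerm_weilConv_weilReflect_eq_spectral {b : ℝ} (hsupp : tsupport g ⊆ Icc (-b) b)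
    {E : ℝ → ℝ} (hEc : Continuous E) (hEs : HasCompactSupport E)
    (hEeq : ∀ x ∈ Icc (-(2 * b)) (2 * b), E x = Real.exp (x / 2) + Real.exp (-(x / 2))) :
    (weilPolarTerm (weilConv g (weilReflect g))).re =
      1 / (2 * π) * ∫ y : ℝ, ‖weilMellin g (1 / 2 + y * I)‖ ^ 2 * cosTransform E y := by
  set k : ℝ → ℂ := weilConv g (weilReflect g) with hk_def
  have hk : IsWeilTest k := hg.weilConv hg.weilReflect
  have hks : tsupport k ⊆ Icc (-(2 * b)) (2 * b) := tsupport_weilConv_weilReflect_subset hg.2 hsupp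
  rw [← re_integral_weilConv_weilReflect_mul_eq hg hEc hEs]
  congr 1
  unfold weilPolarTerm weilMellin
  have i0 : Integrable fun t : ℝ => k t * cexp ((0 - 1 / 2) * t) := hk.integrable_mul (by fun_prop)
  have i1 : Integrable fun t : ℝ => k t * cexp ((1 - 1 / 2) * t) := hk.integrable_mul (by fun_prop)
  rw [← integral_add i0 i1]
  congr 1 with t
  by_cases ht : t ∈ tsupport k
  · have hE := hEeq t (hks ht)
    have e1 : cexp (((0 : ℂ) - 1 / 2) * (t : ℂ)) = ((Real.exp (-(t / 2)) : ℝ) : ℂ) := by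
      rw [Complex.ofReal_exp]; congr 1; push_cast; ring
    have e2 : cexp (((1 : ℂ) - 1 / 2) * (t : ℂ)) = ((Real.exp (t / 2) : ℝ) : ℂ) := by
      rw [Complex.ofReal_exp]; congr 1; push_cast; ring
    rw [e1, e2, show weilConv g (weilReflect g) t = k t from rfl, hE]
    push_cast
    ring
  · have h0 : k t = 0 := image_eq_zero_of_notMem_tsupport ht
    rw [show weilConv g (weilReflect g) t = k t from rfl, h0]
    simp

/-- **The archimedean term, spectrally.** `Re W_∞(g ⋆ g̃) = (1/2π) ∫ |ĝ(1/2+iy)|² Re ψ(1/4+iy/2) dy − (log π)‖g‖₂²`.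
[folklore] -/
theorem re_weilArchTerm_weilConv_weilReflect_eq_spectral :
    (weilArchTerm (weilConv g (weilReflect g))).re =
      1 / (2 * π) * (∫ y : ℝ, ‖weilMellin g (1 / 2 + y * I)‖ ^ 2 *
        Literature.Analysis.SpecialFunctions.reDigammaQuarter y) - Real.log π * weilNorm2Sq g := by
  unfold weilArchTerm
  rw [weilArchIntegral_weilConv_weilReflect hg, weilConv_weilReflect_apply_zero]
  have e : (1 / (2 * π) : ℂ) = ((1 / (2 * π) : ℝ) : ℂ) := by push_cast; ring
  rw [e, Complex.sub_re, Complex.re_ofReal_mul, Complex.ofReal_re, Complex.re_ofReal_mul,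
    Complex.ofReal_re, mul_comm (∫ t : ℝ, ‖g t‖ ^ 2) (Real.log π)]
  rfl

/-- **A node, spectrally.** `Re (G(log n) + G(−log n)) · (a/2) = (1/2π) ∫ |ĝ(1/2+iy)|² · a cos(y log n) dy`
for `G = g ⋆ g̃`. [folklore] -/
theorem re_node_eq_spectral (a L : ℝ) :
    (((a / 2 : ℝ) : ℂ) * (weilConv g (weilReflect g) L + weilConv g (weilReflect g) (-L))).re =
      1 / (2 * π) * ∫ y : ℝ, ‖weilMellin g (1 / 2 + y * I)‖ ^ 2 * (a * Real.cos (y * L)) := by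
  rw [weilConv_weilReflect_add_neg_eq_two_re g L, Complex.re_ofReal_mul, Complex.ofReal_re]
  have h := inv_two_pi_mul_integral_norm_sq_weilMellin_mul_two_cos hg L
  have e : (∫ y : ℝ, ‖weilMellin g (1 / 2 + y * I)‖ ^ 2 * (a * Real.cos (y * L))) =
      a / 2 * ∫ y : ℝ, ‖weilMellin g (1 / 2 + y * I)‖ ^ 2 * (2 * Real.cos (y * L)) := by
    rw [← integral_const_mul]
    congr 1 with y
    ring
  rw [e]
  linear_combination (-(a / 2)) * h

end Terms

section Spectral

variable {g : ℝ → ℂ} (hg : IsWeilTest g) {b : ℝ} (hsupp : tsupport g ⊆ Icc (-b) b)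
  {E : ℝ → ℝ} (hEc : Continuous E) (hEs : HasCompactSupport E)
  (hEeq : ∀ x ∈ Icc (-(2 * b)) (2 * b), E x = Real.exp (x / 2) + Real.exp (-(x / 2)))
include hg hsupp hEc hEs hEeq

/-- **The slack sign-cone functional is a spectral integral against an explicit density.**
For `G = g ⋆ g̃` with `tsupport g ⊆ [-b, b]`, real weights `a_n` on a finite set of nodes and a
slack `s`:
`Re (W_ar(G) − Σ_n (a_n/2)(G(log n) + G(−log n))) + s‖g‖₂² = (1/2π) ∫ |ĝ(1/2+iy)|² F(y) dy`,
`F(y) = Re ψ(1/4+iy/2) − log π + s + Ê(y) − Σ_n a_n cos(y log n)`. [folklore] -/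
theorem slackFunctional_eq_spectralIntegral (s : ℝ) (nodes : Finset ℕ) (a : ℕ → ℝ) :
    (weilPolarTerm (weilConv g (weilReflect g)) + weilArchTerm (weilConv g (weilReflect g)) -
        ∑ n ∈ nodes, ((a n / 2 : ℝ) : ℂ) *
          (weilConv g (weilReflect g) (Real.log n) + weilConv g (weilReflect g) (-Real.log n))).re +
      s * weilNorm2Sq g =
    1 / (2 * π) * ∫ y : ℝ, ‖weilMellin g (1 / 2 + y * I)‖ ^ 2 *
      (Literature.Analysis.SpecialFunctions.reDigammaQuarter y - Real.log π + s + cosTransform E y -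
        ∑ n ∈ nodes, a n * Real.cos (y * Real.log n)) := by
  set ρ : ℝ → ℝ := fun y => ‖weilMellin g (1 / 2 + y * I)‖ ^ 2 with hρ
  -- the four spectral identities
  have hP := re_weilPolarTerm_weilConv_weilReflect_eq_spectral hg hsupp hEc hEs hEeq
  have hA := re_weilArchTerm_weilConv_weilReflect_eq_spectral hg
  have hN : ∀ n ∈ nodes, (((a n / 2 : ℝ) : ℂ) *
      (weilConv g (weilReflect g) (Real.log n) + weilConv g (weilReflect g) (-Real.log n))).re =
      1 / (2 * π) * ∫ y : ℝ, ρ y * (a n * Real.cos (y * Real.log n)) :=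
    fun n _ => re_node_eq_spectral hg (a n) (Real.log n)
  have hPl : weilNorm2Sq g = 1 / (2 * π) * ∫ y : ℝ, ρ y := by
    rw [hρ, integral_norm_sq_weilMellin_half_line hg]
    field_simp
  -- integrability of the pieces
  have iR : Integrable fun y => ρ y * Literature.Analysis.SpecialFunctions.reDigammaQuarter y :=
    integrable_norm_sq_weilMellin_mul_reDigammaQuarter hg
  have i1 : Integrable ρ := integrable_norm_sq_weilMellin_half_line hg
  have iE : Integrable fun y => ρ y * cosTransform E y :=
    integrable_norm_sq_weilMellin_mul hg (continuous_cosTransform hEc hEs).measurable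
      (A := ∫ x : ℝ, |E x|) (B := 0) (integral_nonneg fun x => abs_nonneg _) le_rfl
      fun t => by rw [zero_mul, add_zero]; exact abs_cosTransform_le hEc hEs t
  have iC : ∀ n ∈ nodes, Integrable fun y => ρ y * (a n * Real.cos (y * Real.log n)) := by
    intro n _
    have h := (integrable_norm_sq_weilMellin_mul_two_cos hg (Real.log n)).const_mul (a n / 2)
    refine (integrable_congr (Eventually.of_forall fun y => ?_)).1 h
    simp only [hρ]
    ring
  have iS : Integrable fun y => ρ y * ∑ n ∈ nodes, a n * Real.cos (y * Real.log n) := by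
    have : (fun y => ρ y * ∑ n ∈ nodes, a n * Real.cos (y * Real.log n)) =
        fun y => ∑ n ∈ nodes, ρ y * (a n * Real.cos (y * Real.log n)) := by
      funext y; rw [Finset.mul_sum]
    rw [this]
    exact integrable_finsetSum _ iC
  -- expand the right-hand side
  have eR : (∫ y : ℝ, ρ y *
      (Literature.Analysis.SpecialFunctions.reDigammaQuarter y - Real.log π + s + cosTransform E y -
        ∑ n ∈ nodes, a n * Real.cos (y * Real.log n))) =
      (∫ y, ρ y * Literature.Analysis.SpecialFunctions.reDigammaQuarter y) - Real.log π * (∫ y, ρ y) +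
        s * (∫ y, ρ y) + (∫ y, ρ y * cosTransform E y) -
        ∑ n ∈ nodes, ∫ y, ρ y * (a n * Real.cos (y * Real.log n)) := by
    have e1 : (fun y : ℝ => ρ y *
        (Literature.Analysis.SpecialFunctions.reDigammaQuarter y - Real.log π + s + cosTransform E y -
          ∑ n ∈ nodes, a n * Real.cos (y * Real.log n))) =
        fun y => ρ y * Literature.Analysis.SpecialFunctions.reDigammaQuarter y - Real.log π * ρ y +
          s * ρ y + ρ y * cosTransform E y - ρ y * ∑ n ∈ nodes, a n * Real.cos (y * Real.log n) := by
      funext y; ring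
    have j1 : Integrable (fun y => Real.log π * ρ y) := i1.const_mul _
    have j2 : Integrable (fun y => s * ρ y) := i1.const_mul _
    have j3 : Integrable (fun y => ρ y * Literature.Analysis.SpecialFunctions.reDigammaQuarter y -
        Real.log π * ρ y) := iR.sub j1
    have j4 : Integrable (fun y => ρ y * Literature.Analysis.SpecialFunctions.reDigammaQuarter y -
        Real.log π * ρ y + s * ρ y) := j3.add j2
    have j5 : Integrable (fun y => ρ y * Literature.Analysis.SpecialFunctions.reDigammaQuarter y -
        Real.log π * ρ y + s * ρ y + ρ y * cosTransform E y) := j4.add iE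
    rw [e1, integral_sub j5 iS, integral_add j4 iE, integral_add j3 j2, integral_sub iR j1,
      integral_const_mul, integral_const_mul]
    congr 1
    rw [← integral_finsetSum _ iC]
    congr 1 with y
    rw [Finset.mul_sum]
  -- expand the left-hand side
  rw [Complex.sub_re, Complex.add_re, Complex.re_sum, hP, hA, Finset.sum_congr rfl hN, hPl, eR,
    ← Finset.mul_sum]
  ring

/-- **Positivity transfer.** If the density `F` is pointwise non-negative then
`-s‖g‖₂² ≤ Re (W_ar(G) − Σ_n (a_n/2)(G(log n) + G(−log n)))` for every Weil test `g` supported in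
`[-b, b]` (`G = g ⋆ g̃`). [folklore] -/
theorem neg_slack_le_of_density_nonneg (s : ℝ) (nodes : Finset ℕ) (a : ℕ → ℝ)
    (hF : ∀ y : ℝ, 0 ≤ Literature.Analysis.SpecialFunctions.reDigammaQuarter y - Real.log π + s +
      cosTransform E y - ∑ n ∈ nodes, a n * Real.cos (y * Real.log n)) :
    -(s * weilNorm2Sq g) ≤
      (weilPolarTerm (weilConv g (weilReflect g)) + weilArchTerm (weilConv g (weilReflect g)) -
        ∑ n ∈ nodes, ((a n / 2 : ℝ) : ℂ) *
          (weilConv g (weilReflect g) (Real.log n) + weilConv g (weilReflect g) (-Real.log n))).re := by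
  have h := slackFunctional_eq_spectralIntegral hg hsupp hEc hEs hEeq s nodes a
  have hpos : 0 ≤ 1 / (2 * π) * ∫ y : ℝ, ‖weilMellin g (1 / 2 + y * I)‖ ^ 2 *
      (Literature.Analysis.SpecialFunctions.reDigammaQuarter y - Real.log π + s + cosTransform E y -
        ∑ n ∈ nodes, a n * Real.cos (y * Real.log n)) :=
    mul_nonneg (by positivity) (integral_nonneg fun y => mul_nonneg (sq_nonneg _) (hF y))
  linarith

end Spectral

end Summit.RiemannHypothesis.RiemannHypothesis.Theorems.SignCone

end
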